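import Literature.AnabelianGeometry.AbsoluteAnabelian.AbsTopIII.Thm19KummerContainerEmbeddingProofs
import HarnessLib

/-!
# [AbsTopIII] Thm. 1.9 (d): the embeddings "`k̄_NF^× ↪ lim`", "`K_{Z_NF}^× ↪ lim`" PINNED to the Kummer maps
# (proof-only; abc-iut referee finding N-B14-2)

Mochizuki, *Topics in Absolute Anabelian Geometry III*, §1, Theorem 1.9 (d), manuscript pp. 37–38
(lit key `paper:url-5493eb38cbb7`): "`k̄_NF^× ⊆ K_{Z_NF}^× ↪ lim_{→V} H¹(Π_V, μ_Ẑ(Π_U))` [...] the '`↪`'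
arises from the Kummer map".

Proof-only sequel of `Thm19KummerContainerEmbeddingProofs.lean` (abc-iut-w5-d213, p419376; sub-DAG
`plan/L4/SUBDAG-AbsTopIII-Thm19.md`, rows Thm19.d.r9 / r10).  Referee finding N-B14-2 (referee-abc-iut-ref-b,
minor under-statement): the named statements `Thm19d_functionField` / `Thm19d_constants` ask for SOME
injective homomorphism with the certified image, while print PINS the embedding to the Kummer map.  Over the
one-base-field interface the pinned form cannot be stated (no map from `K_{Z_NF}` / `k̄_NF` to the levels);
over the tower data of the embeddings' construction it can, and it HOLDS BY CONSTRUCTION.  This file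
restates the two existence theorems WITH the pinning conjunct: the embedding sends `a` to the Kummer class
(in the container) of ANY unit `f` of ANY level `j` representing `a` in the tower (`σ_j f = σ_Z a`, resp.
`τ_j c = a`) — `exists_functionFieldEmbedding_kummer`, `exists_constEmbedding_kummer`.  Same binders as the
landed theorems; no definition, no new named fact; nothing here bears on [IUTchIII] Cor. 3.12.
-/

noncomputable section

open CategoryTheory
open scoped Classical

namespace Literature.AnabelianGeometry.AbsoluteAnabelian.AbsTopIII

universe u

namespace IntrinsicKummerModel

variable (M : IntrinsicKummerModel.{u}) {Z : M.Curve} {ι : Type u} [Preorder ι]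
  (S : CurveModel.NFComplementSystem M.toCurveModel Z ι)

section Constants

variable (ρ : ∀ ⦃i j : ι⦄, i ≤ j → (Additive (M.regularUnits (S.V i)) →+ Additive (M.regularUnits (S.V j))))
  (hnat : ∀ ⦃i j : ι⦄ (h : i ≤ j) (f : Additive (M.regularUnits (S.V i))),
    S.transition i j h (M.kummerLevel S i f) = M.kummerLevel S j (ρ h f))
  (hcreg : ∀ (i : ι) (c : (M.base (S.V i))ˣ),
    Units.map (algebraMap (M.base (S.V i)) (M.FunctionField (S.V i)) : _ →* _) c ∈ M.regularUnits (S.V i))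
  (τ : ∀ i : ι, M.base (S.V i) →+* AlgebraicClosure (M.base Z))
  (hτρ : ∀ ⦃i j : ι⦄ (h : i ≤ j) (c : (M.base (S.V i))ˣ), ∃ c' : (M.base (S.V j))ˣ,
    τ j (c' : M.base (S.V j)) = τ i (c : M.base (S.V i)) ∧
      ρ h (Additive.ofMul ⟨_, hcreg i c⟩) = Additive.ofMul ⟨_, hcreg j c'⟩)
  (hτNF : ∀ (i : ι) (c : (M.base (S.V i))ˣ),
    M.IsNFConstant (S.V i) (c : M.base (S.V i)) ↔ τ i (c : M.base (S.V i)) ∈ M.kbarNF Z)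
  (hτexh : ∀ (i : ι) (a : AlgebraicClosure (M.base Z)), a ∈ M.kbarNF Z →
    ∃ j : ι, i ≤ j ∧ a ∈ Set.range (τ j))
  (hinjS : ∀ i : ι, Function.Injective (M.kummerToContainer S i))

include ρ hnat hcreg τ hτρ hτNF hτexh hinjS

/-- **"`k̄_NF^× ↪ lim`" PINNED to the Kummer maps** (referee finding N-B14-2): the embedding of
`exists_constEmbedding` can be chosen — and the constructed one IS — such that `e(a)` is the Kummer class of
the constant `c ∈ k′_j` for ANY level `j` and `c` with `τ_j(c) = a` ("the '`↪`' arises from the Kummer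
map"). [cite: MochizukiAbsTopIII2015, Thm 1.9 (d) p.38] -/
theorem exists_constEmbedding_kummer [Nonempty ι] [IsDirectedOrder ι] :
    ∃ e : Additive (↥(M.kbarNF Z))ˣ →+ S.kummerContainer,
      Function.Injective e ∧ Set.range e = M.nfConstantImage S ∧
        ∀ (a : (↥(M.kbarNF Z))ˣ) (j : ι) (c : (M.base (S.V j))ˣ),
          τ j (c : M.base (S.V j)) = ((a : ↥(M.kbarNF Z)) : AlgebraicClosure (M.base Z)) →
            e (Additive.ofMul a) = M.kummerToContainer S j (Additive.ofMul ⟨_, hcreg j c⟩) := by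
  classical
  obtain ⟨i₀⟩ := ‹Nonempty ι›
  -- every unit of `k̄_NF` is represented by a unit of the base field of some level
  have hrep : ∀ a : (↥(M.kbarNF Z))ˣ, ∃ (j : ι) (c : (M.base (S.V j))ˣ),
      τ j (c : M.base (S.V j)) = ((a : ↥(M.kbarNF Z)) : AlgebraicClosure (M.base Z)) := by
    intro a
    obtain ⟨j, -, c₀, hc₀⟩ := hτexh i₀ _ (a : ↥(M.kbarNF Z)).2
    have hc₀0 : c₀ ≠ 0 := by
      rintro rfl
      apply Units.ne_zero a
      exact Subtype.ext (by rw [← hc₀, map_zero]; rfl)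
    exact ⟨j, Units.mk0 c₀ hc₀0, by rw [Units.val_mk0, hc₀]⟩
  choose J C hJC using hrep
  -- the candidate map; it does not depend on the chosen representation
  let e₀ : (↥(M.kbarNF Z))ˣ → S.kummerContainer := fun a =>
    M.kummerToContainer S (J a) (Additive.ofMul ⟨_, hcreg (J a) (C a)⟩)
  have he₀ : ∀ (a : (↥(M.kbarNF Z))ˣ) (j : ι) (c : (M.base (S.V j))ˣ),
      τ j (c : M.base (S.V j)) = ((a : ↥(M.kbarNF Z)) : AlgebraicClosure (M.base Z)) →
      e₀ a = M.kummerToContainer S j (Additive.ofMul ⟨_, hcreg j c⟩) :=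
    fun a j c hc => M.kummerToContainer_const_eq_of_tau_eq S ρ hnat hcreg τ hτρ (C a) c
      (by rw [hJC a, hc])
  -- multiplicativity: move both representatives to a common level
  have hmul : ∀ x y : (↥(M.kbarNF Z))ˣ, e₀ (x * y) = e₀ x + e₀ y := by
    intro x y
    obtain ⟨k, hxk, hyk⟩ := exists_ge_ge (J x) (J y)
    obtain ⟨c₁, hc₁, -⟩ := hτρ hxk (C x)
    obtain ⟨c₂, hc₂, -⟩ := hτρ hyk (C y)
    have hxy : τ k ((c₁ * c₂ : (M.base (S.V k))ˣ) : M.base (S.V k)) =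
        (((x * y : (↥(M.kbarNF Z))ˣ) : ↥(M.kbarNF Z)) : AlgebraicClosure (M.base Z)) := by
      rw [Units.val_mul, map_mul, hc₁, hc₂, hJC x, hJC y]
      rfl
    rw [he₀ (x * y) k (c₁ * c₂) hxy, he₀ x k c₁ (by rw [hc₁, hJC x]),
      he₀ y k c₂ (by rw [hc₂, hJC y])]
    have hm : (⟨_, hcreg k (c₁ * c₂)⟩ : M.regularUnits (S.V k)) =
        ⟨_, hcreg k c₁⟩ * ⟨_, hcreg k c₂⟩ := Subtype.ext (by simp)
    rw [hm, ofMul_mul, map_add]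
  refine ⟨AddMonoidHom.mk' (fun a => e₀ (Additive.toMul a)) fun a b => hmul _ _, ?_, ?_,
    fun a j c hc => he₀ a j c hc⟩
  · -- injectivity: `κ_{V_j}(c) = 0 ⟹ c = 1` by `Thm19d_inj` and the injectivity of `k′_j → K_{V_j}`
    refine (injective_iff_map_eq_zero _).2 fun a ha => ?_
    obtain ⟨x, rfl⟩ : ∃ x, Additive.ofMul x = a := ⟨Additive.toMul a, rfl⟩
    simp only [AddMonoidHom.mk'_apply, toMul_ofMul] at ha
    have h0 : Additive.ofMul (⟨_, hcreg (J x) (C x)⟩ : M.regularUnits (S.V (J x))) = 0 :=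
      hinjS (J x) (ha.trans (map_zero _).symm)
    have h1 : (⟨_, hcreg (J x) (C x)⟩ : M.regularUnits (S.V (J x))) = 1 := ofMul_eq_zero.1 h0
    have h3 := congrArg Subtype.val h1
    have h4 : (C x : M.base (S.V (J x))) = 1 :=
      (algebraMap (M.base (S.V (J x))) (M.FunctionField (S.V (J x)))).injective
        (by simpa using congrArg Units.val h3)
    have h5 : ((x : ↥(M.kbarNF Z)) : AlgebraicClosure (M.base Z)) = 1 := by
      rw [← hJC x, h4, map_one]
    have h6 : x = 1 := Units.ext (Subtype.ext h5)
    rw [h6, ofMul_one]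
  · -- the image is `nfConstantImage S`
    ext ξ
    simp only [Set.mem_range, AddMonoidHom.mk'_apply]
    constructor
    · rintro ⟨a, rfl⟩
      generalize Additive.toMul a = x
      refine ⟨J x, C x, hcreg (J x) (C x), (hτNF (J x) (C x)).2 ?_, rfl⟩
      rw [hJC x]
      exact (x : ↥(M.kbarNF Z)).2
    · rintro ⟨i, c, hc, hcNF, rfl⟩
      have hmem : τ i (c : M.base (S.V i)) ∈ M.kbarNF Z := (hτNF i c).1 hcNF
      have hne : (⟨τ i (c : M.base (S.V i)), hmem⟩ : ↥(M.kbarNF Z)) ≠ 0 := by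
        intro h0
        have h1 : τ i (c : M.base (S.V i)) = 0 := congrArg Subtype.val h0
        exact c.ne_zero ((τ i).injective (by rw [h1, map_zero]))
      exact ⟨Additive.ofMul (Units.mk0 _ hne), he₀ (Units.mk0 _ hne) i c rfl⟩

end Constants

section FunctionField

variable (ρ : ∀ ⦃i j : ι⦄, i ≤ j → (Additive (M.regularUnits (S.V i)) →+ Additive (M.regularUnits (S.V j))))
  (hnat : ∀ ⦃i j : ι⦄ (h : i ≤ j) (f : Additive (M.regularUnits (S.V i))),
    S.transition i j h (M.kummerLevel S i f) = M.kummerLevel S j (ρ h f))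
  (Ω : Type u) [Field Ω] (σ : ∀ i : ι, M.FunctionField (S.V i) →+* Ω)
  (hσρ : ∀ ⦃i j : ι⦄ (h : i ≤ j) (f : M.regularUnits (S.V i)),
    σ j (((Additive.toMul (ρ h (Additive.ofMul f)) : M.regularUnits (S.V j)) :
      (M.FunctionField (S.V j))ˣ) : M.FunctionField (S.V j)) =
      σ i ((f : (M.FunctionField (S.V i))ˣ) : M.FunctionField (S.V i)))
  (σZ : M.NFFunctionField Z →+* Ω)
  (hσNF : ∀ (i : ι) (g : M.FunctionField (S.V i)), M.IsNFRational (S.V i) g ↔ σ i g ∈ Set.range σZ)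
  (hσexh : ∀ (i : ι) (a : M.NFFunctionField Z), a ≠ 0 → ∃ j : ι, i ≤ j ∧
    ∃ f : M.regularUnits (S.V j), σ j ((f : (M.FunctionField (S.V j))ˣ) : M.FunctionField (S.V j)) = σZ a)
  (hinjS : ∀ i : ι, Function.Injective (M.kummerToContainer S i))

include ρ hnat σ hσρ σZ hσNF hσexh hinjS

/-- **"`K_{Z_NF}^× ↪ lim`" PINNED to the Kummer maps** (referee finding N-B14-2): the embedding of
`exists_functionFieldEmbedding` can be chosen — and the constructed one IS — such that `e(a)` is the Kummer
class of the regular unit `f` of ANY level `j` with `σ_j(f) = σ_Z(a)` ("the '`↪`' arises from the Kummer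
map"). [cite: MochizukiAbsTopIII2015, Thm 1.9 (d) p.38] -/
theorem exists_functionFieldEmbedding_kummer [Nonempty ι] [IsDirectedOrder ι] :
    ∃ e : Additive (M.NFFunctionField Z)ˣ →+ S.kummerContainer,
      Function.Injective e ∧ Set.range e = M.nfRationalImage S ∧
        ∀ (a : (M.NFFunctionField Z)ˣ) (j : ι) (f : M.regularUnits (S.V j)),
          σ j ((f : (M.FunctionField (S.V j))ˣ) : M.FunctionField (S.V j)) = σZ (a : M.NFFunctionField Z) →
            e (Additive.ofMul a) = M.kummerToContainer S j (Additive.ofMul f) := by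
  classical
  obtain ⟨i₀⟩ := ‹Nonempty ι›
  have hrep : ∀ a : (M.NFFunctionField Z)ˣ, ∃ (j : ι) (f : M.regularUnits (S.V j)),
      σ j ((f : (M.FunctionField (S.V j))ˣ) : M.FunctionField (S.V j)) = σZ (a : M.NFFunctionField Z) :=
    fun a => by
      obtain ⟨j, -, f, hf⟩ := hσexh i₀ (a : M.NFFunctionField Z) a.ne_zero
      exact ⟨j, f, hf⟩
  choose J F hJF using hrep
  let e₀ : (M.NFFunctionField Z)ˣ → S.kummerContainer := fun a =>
    M.kummerToContainer S (J a) (Additive.ofMul (F a))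
  have he₀ : ∀ (a : (M.NFFunctionField Z)ˣ) (j : ι) (f : M.regularUnits (S.V j)),
      σ j ((f : (M.FunctionField (S.V j))ˣ) : M.FunctionField (S.V j)) = σZ (a : M.NFFunctionField Z) →
      e₀ a = M.kummerToContainer S j (Additive.ofMul f) :=
    fun a j f hf => M.kummerToContainer_eq_of_sigma_eq S ρ hnat Ω σ hσρ (F a) f (by rw [hJF a, hf])
  have hmul : ∀ x y : (M.NFFunctionField Z)ˣ, e₀ (x * y) = e₀ x + e₀ y := by
    intro x y
    obtain ⟨k, hxk, hyk⟩ := exists_ge_ge (J x) (J y)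
    set f₁ : M.regularUnits (S.V k) := Additive.toMul (ρ hxk (Additive.ofMul (F x))) with hf₁
    set f₂ : M.regularUnits (S.V k) := Additive.toMul (ρ hyk (Additive.ofMul (F y))) with hf₂
    have h₁ : σ k ((f₁ : (M.FunctionField (S.V k))ˣ) : M.FunctionField (S.V k)) =
        σZ (x : M.NFFunctionField Z) := by rw [hf₁, hσρ hxk (F x), hJF x]
    have h₂ : σ k ((f₂ : (M.FunctionField (S.V k))ˣ) : M.FunctionField (S.V k)) =
        σZ (y : M.NFFunctionField Z) := by rw [hf₂, hσρ hyk (F y), hJF y]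
    have hxy : σ k (((f₁ * f₂ : M.regularUnits (S.V k)) : (M.FunctionField (S.V k))ˣ) :
        M.FunctionField (S.V k)) = σZ ((x * y : (M.NFFunctionField Z)ˣ) : M.NFFunctionField Z) := by
      rw [Subgroup.coe_mul, Units.val_mul, map_mul, h₁, h₂, Units.val_mul, map_mul]
    rw [he₀ (x * y) k (f₁ * f₂) hxy, he₀ x k f₁ h₁, he₀ y k f₂ h₂, ofMul_mul, map_add]
  refine ⟨AddMonoidHom.mk' (fun a => e₀ (Additive.toMul a)) fun a b => hmul _ _, ?_, ?_,
    fun a j f hf => he₀ a j f hf⟩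
  · -- injectivity: `κ_{V_j}(f) = 0 ⟹ f = 1` by `Thm19d_inj`, and `σ_Z` is injective
    refine (injective_iff_map_eq_zero _).2 fun a ha => ?_
    obtain ⟨x, rfl⟩ : ∃ x, Additive.ofMul x = a := ⟨Additive.toMul a, rfl⟩
    simp only [AddMonoidHom.mk'_apply, toMul_ofMul] at ha
    have h0 : Additive.ofMul (F x) = 0 := hinjS (J x) (ha.trans (map_zero _).symm)
    have h1 : F x = 1 := ofMul_eq_zero.1 h0
    have h2 : σZ (x : M.NFFunctionField Z) = 1 := by
      rw [← hJF x, h1]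
      simp
    have h3 : (x : M.NFFunctionField Z) = 1 := σZ.injective (by rw [h2, map_one])
    have h4 : x = 1 := Units.ext (by rw [h3, Units.val_one])
    rw [h4, ofMul_one]
  · -- the image is `nfRationalImage S`
    ext ξ
    simp only [Set.mem_range, AddMonoidHom.mk'_apply]
    constructor
    · rintro ⟨a, rfl⟩
      generalize Additive.toMul a = x
      exact ⟨J x, F x, (hσNF (J x) _).2 ⟨(x : M.NFFunctionField Z), (hJF x).symm⟩, rfl⟩
    · rintro ⟨i, f, hf, rfl⟩
      obtain ⟨a, ha⟩ := (hσNF i _).1 hf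
      have ha0 : a ≠ 0 := by
        rintro rfl
        rw [map_zero] at ha
        exact ((f : (M.FunctionField (S.V i))ˣ)).ne_zero ((σ i).injective (by rw [← ha, map_zero]))
      exact ⟨Additive.ofMul (Units.mk0 a ha0), he₀ (Units.mk0 a ha0) i f (by rw [Units.val_mk0, ha])⟩

end FunctionField

end IntrinsicKummerModel

end Literature.AnabelianGeometry.AbsoluteAnabelian.AbsTopIII
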